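import Literature.AlgebraicGeometry.Resolution.LocalBlowup
import Mathlib.RingTheory.Valuation.LocalSubring
import Mathlib.RingTheory.KrullDimension.Basic
import HarnessLib

/-!
# Quadratic transforms of two-dimensional regular local rings (Abhyankar 1956)

Topic: `Literature/AlgebraicGeometry/Resolution`. The birational geometry of two-dimensional
regular local rings along a valuation, in the form used by Cutkosky's counterexample to local
monomialization (`Literature.Barriers.ResolutionOfSingularities.Cutkosky.Cutkosky2014`, whose
discharge this file serves): the two theorems of Abhyankar's *On the valuations centered in a
local domain* that Cutkosky (§2.3) quotes as Theorem 2.1 and Lemma 2.2, vendored as NAMED FACTS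
over REAL definitions of the objects they speak about, plus the proved corollary that is
actually consumed downstream.

## What the sources print (verified on the page)

* Cutkosky 2014, §2.1: "Suppose that `R ⊂ S` is an inclusion of local rings. We will say that
  `S` dominates `R` if `m_S ∩ R = m_R`. If the local ring `R` is a domain with `QF(R) = K` then
  we will say that `R` is a local ring of `K`. … Suppose that `R` is a regular local ring. A
  monoidal transform `R → R₁` of `R` is a local ring of the form `R[P/x]_m` where `P` is a
  regular prime ideal in `R` (`R/P` is a regular local ring), `0 ≠ x ∈ P` and `m` is a prime
  ideal of `R[P/x]` such that `m ∩ R = m_R`. `R₁` is called a quadratic transform if `P = m_R`."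
  §2.2: "If `ν` is a valuation of a field `K` and `R` is a local ring of `K` we will say that `ν`
  dominates `R` if the valuation ring `V_ν` dominates `R`. Suppose that `ν` dominates `R`. A
  monoidal transform `R → R₁` is called a monoidal transform along `ν` if `ν` dominates `R₁`."
  [cite: Cutkosky2014, §2.1–2.2]
* Cutkosky 2014, **Theorem 2.1** "(Theorem 3 [Ab1]) Suppose that `K` is a field, and `R` is a
  regular local ring of dimension two of `K`. Suppose that `S` is another 2 dimensional regular
  local ring of `K` which dominates `R`. Then there exists a unique sequence of quadratic
  transforms `R → R₁ → ⋯ → R_n = S` which factor `R → S`." [cite: Cutkosky2014, Thm. 2.1]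
  (= [cite: Abhyankar1956Valuations, Thm. 3]).
* Cutkosky 2014, **Lemma 2.2** "(Lemma 12 [Ab1]) Suppose that `R` is a two dimensional regular
  local ring of a field `K` and `ν` is a valuation of `K` which dominates `R`. Let
  `R → R₁ → R₂ → ⋯` be the infinite sequence of quadratic transforms along `ν`. Then
  `V_ν = ∪_{i ≥ 1} R_i`." [cite: Cutkosky2014, Lemma 2.2] (= [cite: Abhyankar1956Valuations, Lemma 12]).

## Lean rendering

Everything happens inside one field `K`; local rings of `K` are `Subring K`s. For subrings
`R ≤ S` of a field, "`S` dominates `R`" (`m_S ∩ R = m_R`) is `SubringDominates R S`: `R ≤ S` and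
an element of `R` invertible in `S` is invertible in `R` — for local `R`, `S` literally the
domination order of Mathlib's `LocalSubring K` (`subringDominates_iff`). `IsLocalRingOf R`:
`R` is local with quotient field `K`. `blowupRing R x = R[m_R/x] ⊆ K`. `IsQuadraticTransform R R₁`
is the printed notion: `R₁ = R[m_R/x]_m` for some `0 ≠ x ∈ m_R` and a prime `m` of `R[m_R/x]`
lying over `m_R`, said inside `K` as: `R₁` is local, contains `R[m_R/x]`, consists of fractions
`a/b` (`a, b ∈ R[m_R/x]`, `b` a unit of `R₁`) and dominates `R` (`isQuadraticTransform_iff_…`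
below unfolds it). `IsQuadraticTransformAlong O R R₁` — the quadratic transform ALONG the
valuation ring `O` — is the tree's local blowing up of `R` along its maximal ideal
(`IsLocalBlowupAlong`, `LocalBlowup.lean`): `R₁ = (R[m_R/x])_{m_O ∩ R[m_R/x]}` for `x ∈ m_R` of
minimal value. PROVED: a quadratic transform along `O` is a quadratic transform and conversely a
quadratic transform inside `O` dominated by `O` is the one along `O`; the transform along `O` is
unique; hence, FROM Theorem 2.1, every two-dimensional regular local ring of `K` dominating `R`
and dominated by `O` is a member of the sequence of quadratic transforms of `R` along `O`
(`AbhyankarQuadraticFactorization.exists_eq_of_dominated`, the form in which Cutkosky §3 uses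
Theorem 2.1: "the top row of [the diagram of quadratic transforms] is the complete list of all
two dimensional regular algebraic local rings of `K*` dominating `B` and dominated by `V*`"). NOT here: the uniqueness half of
Theorem 2.1 (not needed downstream; the vendored fact is the existence half, weaker than printed),
monoidal transforms along non-maximal regular primes, and the proofs of the two named facts
(Abhyankar 1956, Theorem 3 and Lemma 12) — they are the targets of later discharges.
-/

noncomputable section

namespace Literature.AlgebraicGeometry.Resolution

universe u

variable {K : Type u} [Field K]

open IsLocalRing

/-! ## Local rings of `K` and domination -/

/-- **`R` is a local ring of `K`** (Cutkosky §2.1): `R ⊆ K` is a local ring (a domain, being a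
subring of a field) with quotient field `QF(R) = K`: every element of `K` is a quotient of
elements of `R`. [cite: Cutkosky2014, §2.1] -/
def IsLocalRingOf (R : Subring K) : Prop :=
  IsLocalRing R ∧ ∀ z : K, ∃ a ∈ R, ∃ b ∈ R, b ≠ 0 ∧ z = a / b

/-- **`S` dominates `R`** for subrings `R ≤ S` of the field `K` (Cutkosky §2.1: `R ⊂ S` and
`m_S ∩ R = m_R`), in the instance-free form "every element of `R` which is invertible in `S` is
invertible in `R`"; for local rings this is the printed condition, i.e. Mathlib's domination
order on `LocalSubring K` (`subringDominates_iff`). [cite: Cutkosky2014, §2.1] -/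
def SubringDominates (R S : Subring K) : Prop :=
  R ≤ S ∧ ∀ x ∈ R, x⁻¹ ∈ S → x⁻¹ ∈ R

/-- In a subring of a field, an element is a unit iff it is nonzero with inverse in the
subring. [folklore] -/
theorem isUnit_subring_iff_inv_mem {R : Subring K} (a : R) :
    IsUnit a ↔ (a : K) ≠ 0 ∧ (a : K)⁻¹ ∈ R := by
  constructor
  · rintro ⟨u, rfl⟩
    have h : ((u : R) : K) * ((↑u⁻¹ : R) : K) = 1 := by
      rw [← Subring.coe_mul, Units.mul_inv, Subring.coe_one]
    refine ⟨left_ne_zero_of_mul_eq_one h, ?_⟩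
    rw [inv_eq_of_mul_eq_one_right h]
    exact (↑u⁻¹ : R).2
  · rintro ⟨h0, hinv⟩
    exact ⟨⟨a, ⟨(a : K)⁻¹, hinv⟩, Subtype.ext (mul_inv_cancel₀ h0),
      Subtype.ext (inv_mul_cancel₀ h0)⟩, rfl⟩

/-- For local subrings, `SubringDominates R S` is Mathlib's domination order
`(R : LocalSubring K) ≤ S` ("`R ≤ S` and the inclusion is a local homomorphism", i.e.
`m_S ∩ R = m_R`). [cite: Cutkosky2014, §2.1] -/
theorem subringDominates_iff (R S : Subring K) [IsLocalRing R] [IsLocalRing S] :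
    SubringDominates R S ↔ LocalSubring.mk R ≤ LocalSubring.mk S := by
  rw [LocalSubring.le_def]
  constructor
  · rintro ⟨hle, h⟩
    refine ⟨hle, ⟨fun a ha => ?_⟩⟩
    rw [isUnit_subring_iff_inv_mem] at ha ⊢
    exact ⟨ha.1, h a a.2 ha.2⟩
  · rintro ⟨hle, hloc⟩
    refine ⟨hle, fun x hx hxS => ?_⟩
    by_cases h0 : x = 0
    · rw [h0, inv_zero]; exact R.zero_mem
    · have hu : IsUnit (Subring.inclusion hle ⟨x, hx⟩) :=
        (isUnit_subring_iff_inv_mem _).mpr ⟨h0, hxS⟩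
      exact ((isUnit_subring_iff_inv_mem _).mp (hloc.map_nonunit _ hu)).2

/-- Domination is reflexive. [folklore] -/
theorem SubringDominates.refl (R : Subring K) : SubringDominates R R :=
  ⟨le_rfl, fun _ _ h => h⟩

/-- Domination is transitive. [folklore] -/
theorem SubringDominates.trans {R S T : Subring K} (h₁ : SubringDominates R S)
    (h₂ : SubringDominates S T) : SubringDominates R T :=
  ⟨h₁.1.trans h₂.1, fun x hx hxT => h₁.2 x hx (h₂.2 x (h₁.1 hx) hxT)⟩

/-- If `T` dominates `R` then so does every intermediate ring `R ≤ S ≤ T`. [folklore] -/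
theorem SubringDominates.of_le_of_le {R S T : Subring K} (h : SubringDominates R T) (h₁ : R ≤ S)
    (h₂ : S ≤ T) : SubringDominates R S :=
  ⟨h₁, fun x hx hxS => h.2 x hx (h₂ hxS)⟩

/-- For a local subring `R`, the maximal ideal consists of `0` and the elements whose inverse
(in `K`) is not in `R`. [folklore] -/
theorem mem_maximalIdeal_iff_inv_not_mem {R : Subring K} [IsLocalRing R] (a : R) :
    a ∈ maximalIdeal R ↔ (a : K) = 0 ∨ (a : K)⁻¹ ∉ R := by
  rw [IsLocalRing.mem_maximalIdeal, mem_nonunits_iff, isUnit_subring_iff_inv_mem]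
  tauto

/-- `O` dominates `R ⊆ O` iff the maximal ideal of `R` is the centre of `O` (elements of value
`< 1`). [folklore] -/
theorem subringDominates_valuationSubring_iff {R : Subring K} [IsLocalRing R]
    {O : ValuationSubring K} (hRO : R ≤ O.toSubring) :
    SubringDominates R O.toSubring ↔ ∀ a : R, a ∈ maximalIdeal R ↔ O.valuation (a : K) < 1 := by
  constructor
  · rintro ⟨-, h⟩ a
    rw [mem_maximalIdeal_iff_inv_not_mem]
    constructor
    · rintro (h0 | hni)
      · rw [h0, map_zero]; exact zero_lt_one
      · -- otherwise `a` is a unit of `O`, so `a⁻¹ ∈ O`, so `a⁻¹ ∈ R`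
        by_contra hge
        have h1 : O.valuation (a : K) = 1 :=
          le_antisymm ((O.valuation_le_one_iff _).mpr (hRO a.2)) (not_lt.mp hge)
        refine hni (h _ a.2 ?_)
        change (a : K)⁻¹ ∈ O
        rw [← O.valuation_le_one_iff, map_inv₀, h1, inv_one]
    · intro hlt
      by_cases h0 : (a : K) = 0
      · exact Or.inl h0
      · refine Or.inr fun hinv => ?_
        have h1 : O.valuation (a : K)⁻¹ ≤ 1 := (O.valuation_le_one_iff _).mpr (hRO hinv)
        rw [map_inv₀, inv_le_one₀ (pos_iff_ne_zero.mpr ((map_ne_zero _).mpr h0))] at h1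
        exact not_lt.mpr h1 hlt
  · intro h
    refine ⟨hRO, fun x hx hxO => ?_⟩
    by_cases h0 : x = 0
    · rw [h0, inv_zero]; exact R.zero_mem
    · by_contra hni
      have hm : (⟨x, hx⟩ : R) ∈ maximalIdeal R :=
        (mem_maximalIdeal_iff_inv_not_mem _).mpr (Or.inr hni)
      have hlt := (h ⟨x, hx⟩).mp hm
      have h1 : O.valuation (x : K)⁻¹ ≤ 1 := (O.valuation_le_one_iff _).mpr hxO
      rw [map_inv₀, inv_le_one₀ (pos_iff_ne_zero.mpr ((map_ne_zero _).mpr h0))] at h1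
      exact not_lt.mpr h1 hlt

/-- `O` dominates the local ring `B_{m_O ∩ B}` at its centre. [folklore] -/
theorem subringDominates_locAtCentre {B : Subring K} {O : ValuationSubring K}
    (h : B ≤ O.toSubring) : SubringDominates (locAtCentre B O) O.toSubring := by
  haveI := isLocalRing_locAtCentre h
  rw [subringDominates_valuationSubring_iff (locAtCentre_le h)]
  exact fun a => mem_maximalIdeal_locAtCentre_iff h a

/-! ## Quadratic transforms (Cutkosky §2.1) -/

/-- The ring `R[m_R/x] ⊆ K` generated over `R` by the fractions `y/x`, `y ∈ m_R` — the affine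
chart "`x ≠ 0`" of the blowing up of the closed point of `Spec R`. [cite: Cutkosky2014, §2.1] -/
def blowupRing (R : Subring K) [IsLocalRing R] (x : K) : Subring K :=
  Subring.closure ((R : Set K) ∪ (fun y : R => (y : K) / x) '' (maximalIdeal R : Set R))

/-- `R ⊆ R[m_R/x]`. [folklore] -/
theorem le_blowupRing (R : Subring K) [IsLocalRing R] (x : K) : R ≤ blowupRing R x :=
  fun _ hy => Subring.subset_closure (Or.inl hy)

/-- `y/x ∈ R[m_R/x]` for `y ∈ m_R`. [folklore] -/
theorem div_mem_blowupRing {R : Subring K} [IsLocalRing R] (x : K) {y : R}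
    (hy : y ∈ maximalIdeal R) : (y : K) / x ∈ blowupRing R x :=
  Subring.subset_closure (Or.inr ⟨y, hy, rfl⟩)

/-- If a finite set `u ⊆ R` generates `m_R` then `R[m_R/x] = R[u/x]`: for `y = Σ rᵢ uᵢ`,
`y/x = Σ rᵢ (uᵢ/x)`. [folklore] -/
theorem blowupRing_eq_closure_of_span_eq {R : Subring K} [IsLocalRing R] (x : K) (u : Set R)
    (hu : Ideal.span u = maximalIdeal R) :
    blowupRing R x = Subring.closure ((R : Set K) ∪ (fun y : R => (y : K) / x) '' u) := by
  apply le_antisymm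
  · refine Subring.closure_le.mpr ?_
    rintro z (hz | ⟨y, hy, rfl⟩)
    · exact Subring.subset_closure (Or.inl hz)
    · change ((y : R) : K) / x ∈ Subring.closure ((R : Set K) ∪ (fun y : R => (y : K) / x) '' u)
      rw [SetLike.mem_coe, ← hu] at hy
      induction hy using Submodule.span_induction with
      | mem y hy => exact Subring.subset_closure (Or.inr ⟨y, hy, rfl⟩)
      | zero => simp
      | add y z _ _ hy hz => rw [Subring.coe_add, add_div]; exact Subring.add_mem _ hy hz
      | smul a y _ hy =>
        rw [smul_eq_mul, Subring.coe_mul, mul_div_assoc]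
        exact Subring.mul_mem _ (Subring.subset_closure (Or.inl a.2)) hy
  · refine Subring.closure_mono ?_
    rintro z (hz | ⟨y, hy, rfl⟩)
    · exact Or.inl hz
    · exact Or.inr ⟨y, hu ▸ Ideal.subset_span hy, rfl⟩

/-- **Quadratic transform** (Cutkosky §2.1, the case `P = m_R` of a monoidal transform):
`R → R₁` is a quadratic transform if `R₁ = R[m_R/x]_m` for some `0 ≠ x ∈ m_R` and a prime ideal
`m` of `R[m_R/x]` with `m ∩ R = m_R`. Inside `K`: `R₁` is a local ring containing `R[m_R/x]`
all of whose elements are fractions `a/b` with `a, b ∈ R[m_R/x]` and `b` a unit of `R₁` (so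
that `R₁` is the localisation of `R[m_R/x]` at the prime `m = m_{R₁} ∩ R[m_R/x]`), and `R₁`
dominates `R` (`m ∩ R = m_R`). The source defines this for `R` regular; the predicate makes
sense for any local `R ⊆ K`. [cite: Cutkosky2014, §2.1] -/
def IsQuadraticTransform (R R₁ : Subring K) : Prop :=
  ∃ (_ : IsLocalRing R) (x : R), x ∈ maximalIdeal R ∧ x ≠ 0 ∧
    IsLocalRing R₁ ∧ blowupRing R (x : K) ≤ R₁ ∧
    (∀ z ∈ R₁, ∃ a ∈ blowupRing R (x : K), ∃ b ∈ blowupRing R (x : K), b⁻¹ ∈ R₁ ∧ z = a / b) ∧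
    SubringDominates R R₁

/-- A quadratic transform dominates its source. [cite: Cutkosky2014, §2.1] -/
theorem IsQuadraticTransform.dominates {R R₁ : Subring K} (h : IsQuadraticTransform R R₁) :
    SubringDominates R R₁ := by
  obtain ⟨_, _, -, -, -, -, -, hdom⟩ := h
  exact hdom

/-- The target of a quadratic transform is a local ring. [cite: Cutkosky2014, §2.1] -/
theorem IsQuadraticTransform.isLocalRing {R R₁ : Subring K} (h : IsQuadraticTransform R R₁) :
    IsLocalRing R₁ := by
  obtain ⟨_, _, -, -, hloc, -⟩ := h
  exact hloc

/-- A chain of quadratic transforms dominates its source. [folklore] -/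
theorem subringDominates_of_reflTransGen {R S : Subring K}
    (h : Relation.ReflTransGen IsQuadraticTransform R S) : SubringDominates R S := by
  induction h with
  | refl => exact SubringDominates.refl R
  | tail _ hq ih => exact ih.trans hq.dominates

/-! ## Quadratic transforms along a valuation (Cutkosky §2.2) -/

/-- **Quadratic transform along the valuation ring `O`** (Cutkosky §2.2: a quadratic transform
`R → R₁` such that `ν` dominates `R₁`): concretely the local blowing up of `R ⊆ O` along its
maximal ideal (`IsLocalBlowupAlong`, Novacoski–Spivakovsky Def. 2.11), i.e.
`R₁ = (R[m_R/x])_{m_O ∩ R[m_R/x]}` for a generator `x` of `m_R` of minimal value. That this IS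
the printed notion is `IsQuadraticTransformAlong.isQuadraticTransform` /
`IsQuadraticTransform.along` below. [cite: Cutkosky2014, §2.2] -/
def IsQuadraticTransformAlong (O : ValuationSubring K) (R R₁ : Subring K) : Prop :=
  ∃ _ : IsLocalRing R, IsLocalBlowupAlong O R (maximalIdeal R) R₁

namespace IsQuadraticTransformAlong

variable {O : ValuationSubring K} {R R₁ R₂ : Subring K}

/-- The source of a quadratic transform along `O` lies in `O`. [folklore] -/
theorem source_le (h : IsQuadraticTransformAlong O R R₁) : R ≤ O.toSubring := by
  obtain ⟨_, H⟩ := h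
  exact H.1

/-- A quadratic transform along `O` is a local blowing up with respect to `O`. [folklore] -/
theorem isLocalBlowup (h : IsQuadraticTransformAlong O R R₁) : IsLocalBlowup O R R₁ := by
  obtain ⟨_, H⟩ := h
  exact H.isLocalBlowup

/-- The target lies in `O`. [folklore] -/
theorem target_le (h : IsQuadraticTransformAlong O R R₁) : R₁ ≤ O.toSubring :=
  h.isLocalBlowup.target_le

/-- The target contains the source. [folklore] -/
theorem le (h : IsQuadraticTransformAlong O R R₁) : R ≤ R₁ :=
  h.isLocalBlowup.le

/-- The target is a local ring. [folklore] -/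
theorem isLocalRing (h : IsQuadraticTransformAlong O R R₁) : IsLocalRing R₁ :=
  h.isLocalBlowup.isLocalRing

/-- The target is dominated by `O` ("along `ν`": `ν` dominates `R₁`). [cite: Cutkosky2014, §2.2] -/
theorem dominated (h : IsQuadraticTransformAlong O R R₁) : SubringDominates R₁ O.toSubring := by
  have hle := h.target_le
  obtain ⟨_, hRO, u, u₀, hu, hu₀, h0, hval, rfl⟩ := h
  refine ⟨hle, fun z hz hzO => ?_⟩
  by_cases hz0 : z = 0
  · rw [hz0, inv_zero]; exact Subring.zero_mem _
  · refine inv_mem_locAtCentre hz (le_antisymm ((O.valuation_le_one_iff _).mpr (hle hz)) ?_)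
    have h1 : O.valuation z⁻¹ ≤ 1 := (O.valuation_le_one_iff _).mpr hzO
    rwa [map_inv₀, inv_le_one₀ (pos_iff_ne_zero.mpr ((map_ne_zero _).mpr hz0))] at h1

/-- The maximal ideal of the source is finitely generated (part of the data of a local blowing
up along it). [folklore] -/
theorem fg_maximalIdeal (h : IsQuadraticTransformAlong O R R₁) :
    ∃ _ : IsLocalRing R, (maximalIdeal R).FG := by
  obtain ⟨_, -, u, u₀, hu, -⟩ := h
  exact ⟨‹_›, u, hu⟩

/-- Unfolding: a quadratic transform along `O` is `(R[m_R/x])_{m_O ∩ R[m_R/x]}` for some nonzero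
`x ∈ m_R` of minimal value. [folklore] -/
theorem exists_eq_locAtCentre (h : IsQuadraticTransformAlong O R R₁) :
    ∃ (_ : IsLocalRing R) (x : R), x ∈ maximalIdeal R ∧ x ≠ 0 ∧
      (∀ y ∈ maximalIdeal R, O.valuation (y : K) ≤ O.valuation (x : K)) ∧
      R₁ = locAtCentre (blowupRing R (x : K)) O := by
  obtain ⟨_, hRO, u, u₀, hu, hu₀, h0, hval, rfl⟩ := h
  refine ⟨‹_›, u₀, hu ▸ Ideal.subset_span (Finset.mem_coe.mpr hu₀), h0, fun y hy => ?_, ?_⟩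
  · rw [← hu] at hy
    induction hy using Submodule.span_induction with
    | mem y hy => exact hval y (Finset.mem_coe.mp hy)
    | zero => simp
    | add y z _ _ hy hz =>
      rw [Subring.coe_add]
      exact (Valuation.map_add _ _ _).trans (max_le hy hz)
    | smul a y _ hy =>
      rw [smul_eq_mul, Subring.coe_mul, map_mul]
      calc O.valuation (a : K) * O.valuation (y : K) ≤ 1 * O.valuation (u₀ : K) :=
            mul_le_mul' ((O.valuation_le_one_iff _).mpr (hRO a.2)) hy
        _ = O.valuation (u₀ : K) := one_mul _
  · rw [blowupRing_eq_closure_of_span_eq (u₀ : K) (↑u) hu]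

/-- **A quadratic transform along `O` is a quadratic transform** (of a source dominated by
`O`): `(R[m_R/x])_{m_O ∩ R[m_R/x]}` is local, consists of fractions with unit denominators, and
dominates `R` because `O` does. [cite: Cutkosky2014, §2.1–2.2] -/
theorem isQuadraticTransform (h : IsQuadraticTransformAlong O R R₁)
    (hO : SubringDominates R O.toSubring) : IsQuadraticTransform R R₁ := by
  have hR₁O := h.target_le
  have hloc := h.isLocalRing
  have hle := h.le
  obtain ⟨_, x, hx, h0, -, rfl⟩ := h.exists_eq_locAtCentre
  refine ⟨‹_›, x, hx, h0, hloc, le_locAtCentre _ O, ?_, hO.of_le_of_le hle hR₁O⟩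
  rintro z ⟨a, ha, b, hb, hvb, rfl⟩
  exact ⟨a, ha, b, hb, inv_mem_locAtCentre (le_locAtCentre _ O hb) hvb, rfl⟩

/-- **Uniqueness of the quadratic transform along a valuation**: the local ring
`(R[m_R/x])_{m_O ∩ R[m_R/x]}` does not depend on the generator `x` of minimal value (for two
such, `x/x'` is a unit of `O`). [cite: Cutkosky2014, §2.2] -/
theorem unique (h₁ : IsQuadraticTransformAlong O R R₁) (h₂ : IsQuadraticTransformAlong O R R₂) :
    R₁ = R₂ := by
  obtain ⟨_, x₁, hx₁, h0₁, hmin₁, rfl⟩ := h₁.exists_eq_locAtCentre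
  obtain ⟨_, x₂, hx₂, h0₂, hmin₂, rfl⟩ := h₂.exists_eq_locAtCentre
  have hRO := h₁.source_le
  have h0₁' : ((x₁ : R) : K) ≠ 0 := fun e => h0₁ (Subtype.ext e)
  have h0₂' : ((x₂ : R) : K) ≠ 0 := fun e => h0₂ (Subtype.ext e)
  have hv : O.valuation (x₁ : K) = O.valuation (x₂ : K) :=
    le_antisymm (hmin₂ x₁ hx₁) (hmin₁ x₂ hx₂)
  -- the key inclusion, symmetric in the two generators
  have key : ∀ (a b : R), (a : K) ≠ 0 → (b : K) ≠ 0 → a ∈ maximalIdeal R →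
      O.valuation (a : K) = O.valuation (b : K) →
      blowupRing R (a : K) ≤ locAtCentre (blowupRing R (b : K)) O := by
    intro a b ha hb ham hab
    refine Subring.closure_le.mpr ?_
    rintro z (hz | ⟨y, hy, rfl⟩)
    · exact le_locAtCentre _ O (le_blowupRing R _ hz)
    · -- `y/a = (y/b) / (a/b)` with `a/b ∈ R[m/b]` of value `1`
      have hab1 : O.valuation ((a : K) / b) = 1 := by
        rw [map_div₀, hab, div_self ((map_ne_zero _).mpr hb)]
      refine ⟨(y : K) / b, div_mem_blowupRing _ hy, (a : K) / b, div_mem_blowupRing _ ham,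
        hab1, ?_⟩
      field_simp
  apply le_antisymm
  · calc locAtCentre (blowupRing R (x₁ : K)) O
        ≤ locAtCentre (locAtCentre (blowupRing R (x₂ : K)) O) O :=
          locAtCentre_mono O (key x₁ x₂ h0₁' h0₂' hx₁ hv)
      _ = locAtCentre (blowupRing R (x₂ : K)) O := locAtCentre_locAtCentre _ O
  · calc locAtCentre (blowupRing R (x₂ : K)) O
        ≤ locAtCentre (locAtCentre (blowupRing R (x₁ : K)) O) O :=
          locAtCentre_mono O (key x₂ x₁ h0₂' h0₁' hx₂ hv.symm)
      _ = locAtCentre (blowupRing R (x₁ : K)) O := locAtCentre_locAtCentre _ O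

end IsQuadraticTransformAlong

/-- **A quadratic transform lying in `O` and dominated by `O` is the quadratic transform along
`O`.** If `R₁ = R[m_R/x]_m ⊆ O` with `O` dominating `R₁` (and `m_R` finitely generated), then
`x` has minimal value in `m_R` (as `m_R/x ⊆ R₁ ⊆ O`) and `m = m_O ∩ R[m_R/x]`, so
`R₁ = (R[m_R/x])_{m_O ∩ R[m_R/x]}`. [cite: Cutkosky2014, §2.2] -/
theorem IsQuadraticTransform.along {O : ValuationSubring K} {R R₁ : Subring K}
    (h : IsQuadraticTransform R R₁) (hfg : ∃ _ : IsLocalRing R, (maximalIdeal R).FG)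
    (h₁ : SubringDominates R₁ O.toSubring) : IsQuadraticTransformAlong O R R₁ := by
  classical
  obtain ⟨_, x, hx, h0, hloc, hT, hfrac, hdom⟩ := h
  obtain ⟨_, s, hs⟩ := hfg
  have hR₁O : R₁ ≤ O.toSubring := h₁.1
  have hRO : R ≤ O.toSubring := (le_blowupRing R (x : K)).trans (hT.trans hR₁O)
  have h0' : ((x : R) : K) ≠ 0 := fun e => h0 (Subtype.ext e)
  -- the generating set `insert x s` of `m_R`, with `x` of minimal value
  have hs' : Ideal.span (↑s : Set R) = maximalIdeal R := hs
  have hspan : Ideal.span (↑(insert x s) : Set R) = maximalIdeal R := by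
    rw [Finset.coe_insert, Ideal.span_insert, hs', sup_eq_right]
    exact (Ideal.span_singleton_le_iff_mem _).mpr hx
  refine ⟨‹_›, hRO, insert x s, x, hspan, Finset.mem_insert_self _ _, h0, ?_, ?_⟩
  · intro y hy
    have hym : y ∈ maximalIdeal R := hspan ▸ Ideal.subset_span (Finset.mem_coe.mpr hy)
    have hyx : (y : K) / x ∈ O := hR₁O (hT (div_mem_blowupRing _ hym))
    rw [← O.valuation_le_one_iff, map_div₀, div_le_one₀
      (pos_iff_ne_zero.mpr ((map_ne_zero _).mpr h0'))] at hyx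
    exact hyx
  · rw [← blowupRing_eq_closure_of_span_eq (x : K) _ hspan]
    apply le_antisymm
    · intro z hz
      obtain ⟨a, ha, b, hb, hbinv, rfl⟩ := hfrac z hz
      by_cases hb0 : b = 0
      · rw [hb0, div_zero]; exact Subring.zero_mem _
      · refine ⟨a, ha, b, hb, le_antisymm ((O.valuation_le_one_iff _).mpr (hR₁O (hT hb))) ?_, rfl⟩
        have h1 : O.valuation b⁻¹ ≤ 1 := (O.valuation_le_one_iff _).mpr (hR₁O hbinv)
        rwa [map_inv₀, inv_le_one₀ (pos_iff_ne_zero.mpr ((map_ne_zero _).mpr hb0))] at h1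
    · rintro _ ⟨a, ha, b, hb, hvb, rfl⟩
      rw [div_eq_mul_inv]
      refine R₁.mul_mem (hT ha) (h₁.2 b (hT hb) ?_)
      -- `b` is a unit of `O`
      have hb0 : b ≠ 0 := ne_zero_of_valuation_eq_one hvb
      change b⁻¹ ∈ O
      rw [← O.valuation_le_one_iff, map_inv₀, hvb, inv_one]

/-! ## The named facts: Abhyankar's factorization theorem and union lemma -/

/-- NAMED FACT — **Abhyankar's factorization theorem** (existence half), as quoted by Cutkosky,
Thm. 2.1 (= Abhyankar 1956, Thm. 3): "Suppose that `K` is a field, and `R` is a regular local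
ring of dimension two of `K`. Suppose that `S` is another 2 dimensional regular local ring of
`K` which dominates `R`. Then there exists a [unique] sequence of quadratic transforms
`R → R₁ → ⋯ → R_n = S` which factor `R → S`." Rendered: a finite chain of quadratic transforms
(`Relation.ReflTransGen IsQuadraticTransform`) leads from `R` to `S`; uniqueness is not
vendored. Users take `(h : AbhyankarQuadraticFactorization)`.
[cite: Cutkosky2014, Thm. 2.1] -/
def AbhyankarQuadraticFactorization : Prop :=
  ∀ (K : Type u) [Field K] (R S : Subring K),
    IsRegularLocalRing R → ringKrullDim R = 2 → IsLocalRingOf R →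
    IsRegularLocalRing S → ringKrullDim S = 2 → SubringDominates R S →
    Relation.ReflTransGen IsQuadraticTransform R S

/-- NAMED FACT — **Abhyankar's union lemma**, as quoted by Cutkosky, Lemma 2.2 (= Abhyankar 1956,
Lemma 12): "Suppose that `R` is a two dimensional regular local ring of a field `K` and `ν` is a
valuation of `K` which dominates `R`. Let `R → R₁ → R₂ → ⋯` be the infinite sequence of
quadratic transforms along `ν`. Then `V_ν = ∪_{i≥1} R_i`." Rendered for the valuation ring
`O = V_ν` and any sequence `R_•` with `R_0 = R` and `R_{i+1}` the quadratic transform of `R_i`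
along `O` (unique by `IsQuadraticTransformAlong.unique`): an element of `K` lies in `O` iff it
lies in some `R_i`. Users take `(h : AbhyankarQuadraticUnion)`. [cite: Cutkosky2014, Lemma 2.2] -/
def AbhyankarQuadraticUnion : Prop :=
  ∀ (K : Type u) [Field K] (O : ValuationSubring K) (R : ℕ → Subring K),
    IsRegularLocalRing (R 0) → ringKrullDim (R 0) = 2 → IsLocalRingOf (R 0) →
    SubringDominates (R 0) O.toSubring →
    (∀ i, IsQuadraticTransformAlong O (R i) (R (i + 1))) →
    ∀ z : K, z ∈ O ↔ ∃ i, z ∈ R i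

/-! ## Consequences consumed by Cutkosky's counterexample -/

/-- Along a sequence of quadratic transforms along `O`, every member lies in `O`, is dominated by
`O`, and dominates `R_0`. [folklore] -/
theorem sequence_dominates {O : ValuationSubring K} {R : ℕ → Subring K}
    (h0 : SubringDominates (R 0) O.toSubring)
    (hstep : ∀ i, IsQuadraticTransformAlong O (R i) (R (i + 1))) (n : ℕ) :
    SubringDominates (R n) O.toSubring ∧ SubringDominates (R 0) (R n) := by
  induction n with
  | zero => exact ⟨h0, SubringDominates.refl _⟩
  | succ n ih =>
    exact ⟨(hstep n).dominated, ih.2.trans (((hstep n).isQuadraticTransform ih.1).dominates)⟩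

/-- The sequence of quadratic transforms along `O` is monotone. [folklore] -/
theorem sequence_monotone {O : ValuationSubring K} {R : ℕ → Subring K}
    (hstep : ∀ i, IsQuadraticTransformAlong O (R i) (R (i + 1))) : Monotone R :=
  monotone_nat_of_le_succ fun n => (hstep n).le

/-- **The form in which Cutkosky §3 uses Theorem 2.1**: granted Abhyankar's factorization
theorem, if `R = R_0 → R_1 → ⋯` is the sequence of quadratic transforms of the two-dimensional
regular local ring `R` of `K` along a valuation ring `O` dominating `R`, then every
two-dimensional regular local ring `S` of `K` which dominates `R` and is dominated by `O` is one
of the `R_n` ("the top row of [the diagram] is the complete list of all two dimensional regular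
algebraic local rings of `K*` dominating `B` and dominated by `V*` (by Theorem 2.1)"). Proof: factor
`R → S` into quadratic transforms; each factor lies in `S ⊆ O` and is dominated by `O`, hence is
the transform along `O`, which is unique. [cite: Cutkosky2014, §3 (p. 7)] -/
theorem AbhyankarQuadraticFactorization.exists_eq_of_dominated
    (hF : AbhyankarQuadraticFactorization.{u}) {O : ValuationSubring K} {R : ℕ → Subring K}
    (hreg : IsRegularLocalRing (R 0)) (hdim : ringKrullDim (R 0) = 2) (hof : IsLocalRingOf (R 0))
    (hstep : ∀ i, IsQuadraticTransformAlong O (R i) (R (i + 1)))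
    {S : Subring K} (hS : IsRegularLocalRing S) (hSdim : ringKrullDim S = 2)
    (hRS : SubringDominates (R 0) S) (hSO : SubringDominates S O.toSubring) :
    ∃ n, S = R n := by
  have hchain := hF K (R 0) S hreg hdim hof hS hSdim hRS
  -- induction over the chain of (abstract) quadratic transforms ending at `S`
  suffices H : ∀ S', Relation.ReflTransGen IsQuadraticTransform (R 0) S' →
      SubringDominates S' O.toSubring → ∃ n, S' = R n from H S hchain hSO
  intro S' hS'
  induction hS' with
  | refl => exact fun _ => ⟨0, rfl⟩
  | @tail T S'' _ hq ih =>
    intro hS''O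
    -- `T` is dominated by `S''`, hence by `O`; so `T = R n`
    obtain ⟨n, rfl⟩ := ih (hq.dominates.trans hS''O)
    -- `S''` is a quadratic transform of `R n` inside `O`, dominated by `O`: it is `R (n+1)`
    exact ⟨n + 1, (hq.along (hstep n).fg_maximalIdeal hS''O).unique (hstep n)⟩

end Literature.AlgebraicGeometry.Resolution

end
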